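import Mathlib
import Summits.ResolutionOfSingularities.ResolutionOfSingularities.Theorems.RadicialJungCleanModelsCleanLU3ArcCoordinates
import HarnessLib

/-!
# Route `RadicialJung`, crux `CleanModels` (stmt-15917), stub `stub_cleanLU3Defect`, class (A) «arcs»: arc coordinates along the
# whole quadratic sequence, and density of the first ring in the valuation ring

Line `Sketch` rev 18 of crux stmt-ResolutionOfSingularities-15917, memo `Cruxes/CleanModels/Lines/Sketch-memo-defect-residue.md` §3; lead
`res-B-lead-1` g2.  OURS; nothing here proves resolution in characteristic `p`.  Continues `…CleanLU3ArcCoordinates.lean`.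

* `maximalIdeal_quadraticSeq_arc` — along the quadratic sequence `R₀ → R₁ → ⋯` along `O`, arc coordinates `(π, u, w)` of `R₀` with
  `v u, v w ≤ v π ^ M` give arc coordinates `(π, u/πⁿ, w/πⁿ)` of `Rₙ` for `n + 1 ≤ M`.
* `exists_approx_of_dense` — if `π ∈ R ⊆ O` and every residue of `O` is attained by `R` (`∀ y ∈ O, ∃ r ∈ R, v (y - r) < 1`), then `R` is
  `v`-adically dense in `O`: `∀ y ∈ O, ∀ N, ∃ r ∈ R, v (y - r) ≤ v π ^ N`; with `r ∈ π R` when `v y ≤ v π` (`exists_approx_mul_of_dense`),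
  the form used to deepen a coordinate `y ∈ 𝔪_R` into an arc coordinate `u = y - Φ`, `Φ ∈ π R`.
-/

noncomputable section

set_option linter.dupNamespace false -- mandated namespace of this single-conjunct summit

open IsLocalRing
open Literature.AlgebraicGeometry.Resolution

namespace Summit.ResolutionOfSingularities.ResolutionOfSingularities.Theorems.RadicialJung.CleanModels

variable {K : Type} [Field K]

/-! ## Arc coordinates along the quadratic sequence -/

/-- **Arc coordinates along the quadratic sequence.** [folklore] -/
theorem maximalIdeal_quadraticSeq_arc {O : ValuationSubring K} (R : ℕ → Subring K) [hR : ∀ i, IsLocalRing (R i)]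
    (h0 : SubringDominates (R 0) O.toSubring) (hstep : ∀ i, IsQuadraticTransformAlong O (R i) (R (i + 1)))
    (π u w : K) (hπR : π ∈ R 0) (huR : u ∈ R 0) (hwR : w ∈ R 0)
    (hm : maximalIdeal (R 0) = Ideal.span {(⟨π, hπR⟩ : R 0), ⟨u, huR⟩, ⟨w, hwR⟩}) (hπ0 : π ≠ 0)
    (hπ : ∀ x : K, O.valuation x < 1 → O.valuation x ≤ O.valuation π) {M : ℕ}
    (hu : O.valuation u ≤ O.valuation π ^ M) (hw : O.valuation w ≤ O.valuation π ^ M) :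
    ∀ n : ℕ, n + 1 ≤ M →
      ∃ (hπn : π ∈ R n) (hun : u / π ^ n ∈ R n) (hwn : w / π ^ n ∈ R n),
        maximalIdeal (R n) = Ideal.span {(⟨π, hπn⟩ : R n), ⟨u / π ^ n, hun⟩, ⟨w / π ^ n, hwn⟩} := by
  have hvπ1 : O.valuation π ≤ 1 := (O.valuation_le_one_iff _).mpr (h0.1 hπR)
  have hvπpos : 0 < O.valuation π := zero_lt_iff.mpr ((Valuation.ne_zero_iff _).mpr hπ0)
  intro n
  induction n with
  | zero =>
    intro _
    refine ⟨hπR, by rw [pow_zero, div_one]; exact huR, by rw [pow_zero, div_one]; exact hwR, ?_⟩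
    rw [hm]
    simp only [pow_zero, div_one]
  | succ n ih =>
    intro hn
    obtain ⟨hπn, hun, hwn, hmn⟩ := ih (Nat.le_of_succ_le hn)
    have hdomn : SubringDominates (R n) O.toSubring := (sequence_dominates h0 hstep n).1
    -- the coordinates at level `n` are still deep: `v (u/πⁿ) ≤ v π ^ (M - n) ≤ v π ^ 2`
    have hdeep : ∀ t : K, O.valuation t ≤ O.valuation π ^ M → O.valuation (t / π ^ n) ≤ O.valuation π ^ 2 := by
      intro t ht
      rw [map_div₀, map_pow, div_le_iff₀ (pow_pos hvπpos n), ← pow_add]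
      exact ht.trans (pow_le_pow_right_of_le_one' hvπ1 (by omega))
    obtain ⟨hu₁, hw₁, hπ₁, hm₁⟩ := maximalIdeal_quadraticTransform_arc (hstep n) hdomn ⟨π, hπn⟩ ⟨u / π ^ n, hun⟩
      ⟨w / π ^ n, hwn⟩ hmn hπ0 hπ (hdeep u hu) (hdeep w hw)
    have heu : u / π ^ n / π = u / π ^ (n + 1) := by rw [div_div, pow_succ]
    have hew : w / π ^ n / π = w / π ^ (n + 1) := by rw [div_div, pow_succ]
    have hu₂ : u / π ^ (n + 1) ∈ R (n + 1) := heu ▸ hu₁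
    have hw₂ : w / π ^ (n + 1) ∈ R (n + 1) := hew ▸ hw₁
    refine ⟨hπ₁, hu₂, hw₂, ?_⟩
    rw [hm₁]
    have e1 : (⟨u / π ^ n / π, hu₁⟩ : R (n + 1)) = ⟨u / π ^ (n + 1), hu₂⟩ := Subtype.ext heu
    have e2 : (⟨w / π ^ n / π, hw₁⟩ : R (n + 1)) = ⟨w / π ^ (n + 1), hw₂⟩ := Subtype.ext hew
    rw [e1, e2]

/-! ## Density of the first ring in the valuation ring -/

/-- **`v`-adic density from residue surjectivity.** If `π ∈ R ⊆ O`, every value `< 1` is `≤ v π`, and every residue of `O` is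
attained by `R`, then every `y ∈ O` is approximated by elements of `R` to any order `v π ^ N`. [folklore] -/
theorem exists_approx_of_dense {O : ValuationSubring K} {R : Subring K} {π : K} (hπR : π ∈ R)
    (hπ : ∀ x : K, O.valuation x < 1 → O.valuation x ≤ O.valuation π)
    (hres : ∀ y : K, y ∈ O → ∃ r : K, r ∈ R ∧ O.valuation (y - r) < 1) :
    ∀ (N : ℕ) (y : K), y ∈ O → ∃ r : K, r ∈ R ∧ O.valuation (y - r) ≤ O.valuation π ^ N := by
  intro N
  induction N with
  | zero =>
    intro y hy
    exact ⟨0, R.zero_mem, by rw [sub_zero, pow_zero]; exact (O.valuation_le_one_iff _).mpr hy⟩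
  | succ n ih =>
    intro y hy
    by_cases hπ0 : π = 0
    · -- degenerate: every value `< 1` is `0`
      obtain ⟨r, hr, hvr⟩ := hres y hy
      refine ⟨r, hr, ?_⟩
      have := hπ _ hvr
      rw [hπ0, map_zero, le_zero_iff] at this
      rw [this]; exact zero_le
    obtain ⟨r₀, hr₀, hv₀⟩ := hres y hy
    have hv₀' : O.valuation (y - r₀) ≤ O.valuation π := hπ _ hv₀
    -- `(y - r₀)/π ∈ O`
    have hmem : (y - r₀) / π ∈ O := by
      rw [← O.valuation_le_one_iff, map_div₀]
      exact div_le_one_of_le₀ hv₀' zero_le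
    obtain ⟨r₁, hr₁, hv₁⟩ := ih ((y - r₀) / π) hmem
    refine ⟨r₀ + π * r₁, R.add_mem hr₀ (R.mul_mem hπR hr₁), ?_⟩
    have heq : y - (r₀ + π * r₁) = π * ((y - r₀) / π - r₁) := by field_simp; ring
    rw [heq, map_mul, pow_succ']
    exact mul_le_mul_right hv₁ _

/-- The same with the approximant in `π R` when `v y ≤ v π`: `y - π r` for some `r ∈ R`. [folklore] -/
theorem exists_approx_mul_of_dense {O : ValuationSubring K} {R : Subring K} {π : K} (hπR : π ∈ R)
    (hπ0 : π ≠ 0) (hπ : ∀ x : K, O.valuation x < 1 → O.valuation x ≤ O.valuation π)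
    (hres : ∀ y : K, y ∈ O → ∃ r : K, r ∈ R ∧ O.valuation (y - r) < 1)
    (N : ℕ) (y : K) (hy : O.valuation y ≤ O.valuation π) :
    ∃ r : K, r ∈ R ∧ O.valuation (y - π * r) ≤ O.valuation π ^ (N + 1) := by
  have hmem : y / π ∈ O := by
    rw [← O.valuation_le_one_iff, map_div₀]
    exact div_le_one_of_le₀ hy zero_le
  obtain ⟨r, hr, hv⟩ := exists_approx_of_dense hπR hπ hres N (y / π) hmem
  refine ⟨r, hr, ?_⟩
  have heq : y - π * r = π * (y / π - r) := by field_simp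
  rw [heq, map_mul, pow_succ']
  exact mul_le_mul_right hv _

end Summit.ResolutionOfSingularities.ResolutionOfSingularities.Theorems.RadicialJung.CleanModels

end
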